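import Literature.Probability.RandomPlanarGeometry.SLESixHullLocalityReduction
import HarnessLib

/-!
# Locality of chordal SLE₆ for hull subdomains — reduced to the NEIGHBOURHOOD half-plane form

Topic `Probability/RandomPlanarGeometry`; theorems only. Same reduction as
`SLESixHullLocalityReduction.lean` (`IsSLELaw.locality_six_bounded_of_hull`), but consuming only the
neighbourhood form `sle_six_hull_locality_nbhd` of the half-plane fact (`SLESixHullLocalityFact.lean`):
the pulled-back stopping set `S' = Ψ⁻¹(G)` contains a uniform neighbourhood of the hull `A` in
the closed half-plane, by uniform continuity of `Ψ` on a compact neighbourhood of `A`,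
`Ψ(A) ⊆ F` and `G ⊇ F_δ`.

* `measure_stopAt_preimage_eq_of_hull_nbhd`, **`IsSLELaw.locality_six_bounded_of_hull_nbhd`**.

References: Lawler–Schramm–Werner, Acta Math. 187 (2001), Thm. 2.2, Cor. 2.4; JAMS 16 (2003), §5.
-/

noncomputable section

open Set Filter Topology MeasureTheory Complex Metric
open UpperHalfPlane (upperHalfPlaneSet)
open scoped NNReal unitInterval

namespace Literature.Probability.RandomPlanarGeometry

open Literature.Probability.Process

/-! ### The core reduction -/

/-- **Core of the reduction, neighbourhood form** (for a fixed chordal map `ψ` of `(D; a, b)`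
realising `μ`): for a closed `G` containing a thickening of `F = closure (D ∖ D')` and a ball
around `b` — so that the pulled-back stopping set contains a uniform neighbourhood of the hull —, the
law of the `μ'`-class stopped at `G` equals that of the `μ`-class stopped at `G`, given the
half-plane fact. [cite: LawlerSchrammWerner2001, Thm 2.2 and Cor 2.4] -/
theorem measure_stopAt_preimage_eq_of_hull_nbhd (hH : sle_six_hull_locality_nbhd) {D D' : DobrushinDomain}
    (hD' : D.IsHullSubdomain D') (hne : D'.carrier ≠ D.carrier)
    {Γ : (ℝ≥0 → ℝ) → CurveClass ℂ} (hΓm : AEMeasurable Γ preWienerMeasure)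
    (ψ : ConformalEquiv upperHalfPlaneSet D.carrier) (hψ : D.IsChordalUniformizing ψ)
    (hae : ∀ᵐ ω ∂preWienerMeasure, Loewner.IsGeneratedByCurve (sleDriving 6 ω) (sleTrace 6 ω) ∧
      ∃ c : Curve ℂ, Γ ω = CurveClass.mk c ∧
        IsCompactifiedImage ψ.boundaryExtension (sleTrace 6 ω) (D.pt 1) c)
    {μ' : Measure (CurveClass ℂ)} (hμ' : IsSLELaw 6 D' μ')
    {G : Set ℂ} (hG : IsClosed G)
    {δ : ℝ} (hδ : 0 < δ) (hFG : cthickening δ (closure (D.carrier \ D'.carrier)) ⊆ G)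
    {r : ℝ} (hr : 0 < r) (hbG : closedBall (D.pt 1) r ⊆ G)
    {T : Set (CurveClass ℂ)} (hT : MeasurableSet T) :
    μ' (CurveClass.stopAt G ⁻¹' T) = preWienerMeasure.map Γ (CurveClass.stopAt G ⁻¹' T) := by
  have hC := JordanDomain.exists_continuousOn_extension_holds
  have hext := JordanDomain.continuousOn_boundaryExtension_holds
  have hcl : closure upperHalfPlaneSet = {w : ℂ | 0 ≤ w.im} := Complex.closure_setOf_lt_im 0
  have hTr : HasSLETrace 6 := hae.mono fun ω hω ↦ ⟨_, hω.1⟩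
  have htr := tendsto_norm_sleTrace_atTop_of_ne_eight (κ := 6) (by norm_num) (by norm_num)
  -- the pulled-back hull and the chordal map `ψ' = ψ ∘ Φ_A⁻¹` of `D'`
  set A : Set ℂ := ψ.pullbackHull D' with hAdef
  have hA : IsStarHull A := IsStarHull.pullbackHull JordanDomain.isSimplyConnected_holds hψ hD'
  have hAne : A.Nonempty := ConformalEquiv.pullbackHull_nonempty (ψ := ψ) hD'.carrier_subset hne
  have hAcl : IsClosed A := hA.1.isClosed
  set ψ' := ψ.pullbackChordal hD'.carrier_subset hA with hψ'def
  have hψ' : D'.IsChordalUniformizing ψ' := ConformalEquiv.isChordalUniformizing_pullbackChordal hψ hD' hA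
  have hb' : D'.pt 1 = D.pt 1 := hD'.pt_one_eq
  -- `μ'` through `ψ'`
  obtain ⟨Γ', hΓ'm, hae'⟩ := exists_isSLECurve_through_of_ae_tendsto (D := D') hTr htr hext
    (aemeasurable_sleTrace_holds hTr) hψ'
  have hμ'eq : μ' = preWienerMeasure.map Γ' :=
    hμ'.eq_map_of_isSLECurve (IsSLECurve.of_through hψ' hΓ'm hae')
  rw [hμ'eq, CurveClass.map_apply_stopAt_preimage hΓ'm hG hT,
    CurveClass.map_apply_stopAt_preimage hΓm hG hT]
  -- continuous extensions and the transported test set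
  have hΨcont : ContinuousOn ψ.boundaryExtension (closure upperHalfPlaneSet) := hext D.toJordanDomain ψ
  have hΨ'cont : ContinuousOn ψ'.boundaryExtension (closure upperHalfPlaneSet) :=
    hext D'.toJordanDomain ψ'
  obtain ⟨Ψs, hΨs⟩ := exists_continuousMap_eq_of_continuousOn_closure hΨ'cont
  set T' : Set (CurveClass ℂ) := CurveClass.map Ψs ⁻¹' T with hT'def
  have hT' : MeasurableSet T' := hT.preimage (CurveClass.measurable_map Ψs)
  -- the stopping sets in the half-plane
  set S : Set ℂ := {w | 0 ≤ w.im ∧ ψ'.boundaryExtension w ∈ G} with hSdef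
  set S' : Set ℂ := {z | 0 ≤ z.im ∧ ψ.boundaryExtension z ∈ G} with hS'def
  have hclosed : ∀ {Φ : ℂ → ℂ}, ContinuousOn Φ (closure upperHalfPlaneSet) →
      IsClosed {w : ℂ | 0 ≤ w.im ∧ Φ w ∈ G} := fun {Φ} hΦ ↦ by
    have : {w : ℂ | 0 ≤ w.im ∧ Φ w ∈ G} = closure upperHalfPlaneSet ∩ Φ ⁻¹' G := by
      rw [hcl]; rfl
    rw [this]
    exact hΦ.preimage_isClosed_of_isClosed (hcl ▸ isClosed_le continuous_const Complex.continuous_im) hG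
  have hS : IsClosed S := hclosed hΨ'cont
  have hS'c : IsClosed S' := hclosed hΨcont
  -- the dictionary `z ∈ S' ↔ E_A z ∈ S`
  have hdict : ∀ z : ℂ, 0 ≤ z.im → z ∉ A → (z ∈ S' ↔ starMap A z ∈ S) := fun z hz hzA ↦ by
    simp only [hSdef, hS'def, mem_setOf_eq]
    rw [ConformalEquiv.boundaryExtension_pullbackChordal_starMap hD'.carrier_subset hA hz hzA]
    exact ⟨fun h ↦ ⟨starMap_im_nonneg hA hz hzA, h.2⟩, fun h ↦ ⟨hz, h.2⟩⟩
  -- large half-plane points are in `S'` and in `S`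
  obtain ⟨R', hR'⟩ := exists_forall_mem_of_tendsto_cocompact
    (MarkedDomain.IsChordalUniformizing.tendsto_boundaryExtension_cocompact hψ) hr hbG
  obtain ⟨R, hR⟩ := exists_forall_mem_of_tendsto_cocompact
    (MarkedDomain.IsChordalUniformizing.tendsto_boundaryExtension_cocompact hψ') hr (hb' ▸ hbG)
  -- `Ψ(A) ⊆ F`
  have hΨA : ∀ z ∈ A, ψ.boundaryExtension z ∈ closure (D.carrier \ D'.carrier) := fun z hz ↦
    ConformalEquiv.boundaryExtension_mem_closure_diff_of_mem_pullbackHull hΨcont hz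
  -- the a.s. strict hitting hypothesis of the half-plane fact
  have hlt : ∀ᵐ ω ∂preWienerMeasure, firstHit (sleTrace 6 ω) S' < firstHit (sleTrace 6 ω) A := by
    filter_upwards [hae, htr] with ω hω hωtr
    have hgen := hω.1
    have him := hgen.im_nonneg
    have h0 : sleTrace 6 ω 0 ∉ A := by
      rw [hgen.apply_zero, sleDriving_zero]
      exact_mod_cast ConformalEquiv.zero_notMem_pullbackHull hψ hD'
    have hfin : firstHit (sleTrace 6 ω) S' ≠ ⊤ :=
      firstHit_ne_top_of_tendsto_norm him hωtr fun z hz hRz ↦ ⟨hz, hR' z hz hRz⟩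
    exact firstHit_lt_firstHit_of_thickening hgen.continuous hAcl h0
      (continuous_comp_of_isGeneratedByCurve hΨcont hgen) hΨA hδ hFG
      (fun t ht ↦ ⟨him t, ht⟩) hfin
  -- `S'` contains a uniform neighbourhood of `A` in the closed half-plane (uniform continuity of
  -- `Ψ` on a compact neighbourhood of `A`, `Ψ(A) ⊆ F`, `G ⊇ F_δ`)
  have hnbhd : ∃ δ'' : ℝ, 0 < δ'' ∧ ∀ z : ℂ, 0 ≤ z.im → Metric.infDist z A ≤ δ'' → z ∈ S' := by
    have hAcpt : IsCompact A := hA.1.isCompact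
    set K : Set ℂ := cthickening 1 A ∩ {z : ℂ | 0 ≤ z.im} with hKdef
    have hKcpt : IsCompact K := (hAcpt.cthickening (r := 1)).inter_right
      (isClosed_le continuous_const Complex.continuous_im)
    have hKsub : K ⊆ closure upperHalfPlaneSet := fun z hz ↦ by rw [hcl]; exact hz.2
    have huc : UniformContinuousOn ψ.boundaryExtension K :=
      hKcpt.uniformContinuousOn_of_continuous (hΨcont.mono hKsub)
    obtain ⟨η, hη, hηδ⟩ := Metric.uniformContinuousOn_iff.1 huc δ hδ
    refine ⟨min (η / 2) (1 / 2), lt_min (by linarith) (by norm_num), fun z hz hdz ↦ ?_⟩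
    have hdz' : Metric.infDist z A < min η 1 := by
      refine lt_of_le_of_lt hdz (lt_min ?_ ?_)
      · exact lt_of_le_of_lt (min_le_left _ _) (by linarith)
      · exact lt_of_le_of_lt (min_le_right _ _) (by norm_num)
    obtain ⟨a, haA, hza⟩ := (Metric.infDist_lt_iff hAne).1 hdz'
    have hAsub : A ⊆ {w : ℂ | 0 ≤ w.im} := by
      rw [← hA.1.2.1, ← hcl]; exact closure_mono inter_subset_right
    have haK : a ∈ K := ⟨Metric.self_subset_cthickening A haA, hAsub haA⟩
    have hzK : z ∈ K :=
      ⟨Metric.mem_cthickening_of_dist_le z a 1 A haA (hza.le.trans (min_le_right _ _)), hz⟩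
    have h1 : dist (ψ.boundaryExtension z) (ψ.boundaryExtension a) < δ :=
      hηδ z hzK a haK (lt_of_lt_of_le hza (min_le_left _ _))
    exact ⟨hz, hFG (Metric.mem_cthickening_of_dist_le _ _ _ _ (hΨA a haA) h1.le)⟩
  obtain ⟨δ'', hδ''⟩ := hnbhd
  have key := hH hA hAne hS hS'c hdict ⟨δ'', hδ''⟩ hlt T' hT'
  -- identification of the `μ`-event
  have h1 : Γ ⁻¹' (CurveClass.stopAt G ⁻¹' T) =ᵐ[preWienerMeasure]
      {ω | stoppedPathClass (starMap A) (sleTrace 6 ω)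
        ((firstHit (sleTrace 6 ω) S').untopD 0) ∈ T'} := by
    filter_upwards [hae, hlt, htr] with ω hω hωlt hωtr
    obtain ⟨hgen, c, hΓc, hc⟩ := hω
    have him := hgen.im_nonneg
    have hfin : firstHit (sleTrace 6 ω) S' ≠ ⊤ :=
      firstHit_ne_top_of_tendsto_norm him hωtr fun z hz hRz ↦ ⟨hz, hR' z hz hRz⟩
    obtain ⟨τ, hτ, -⟩ := exists_firstHit_eq_coe hgen.continuous hS'c hfin
    refine propext ?_
    change Γ ω ∈ CurveClass.stopAt G ⁻¹' T ↔
      stoppedPathClass (starMap A) (sleTrace 6 ω)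
        ((firstHit (sleTrace 6 ω) S').untopD 0) ∈ CurveClass.map Ψs ⁻¹' T
    rw [hΓc, mem_preimage, CurveClass.stopAt_mk_holds _ hG, mem_preimage, hτ, WithTop.untopD_coe]
    have hΨF : ∀ t, ψ.boundaryExtension (sleTrace 6 ω t) ∈ G ↔ sleTrace 6 ω t ∈ S' :=
      fun t ↦ ⟨fun h ↦ ⟨him t, h⟩, fun h ↦ h.2⟩
    have hcontψ := continuous_comp_of_isGeneratedByCurve hΨcont hgen
    have hA' := mk_stopAt_eq_stoppedPathClass hG hS'c hgen.continuous hΨF hc hτ hcontψ.continuousOn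
    rw [hA']
    -- off `A` up to time `τ`
    have hτA : (τ : WithTop ℝ≥0) < firstHit (sleTrace 6 ω) A := hτ ▸ hωlt
    have hnotA : ∀ s : I, sleTrace 6 ω (((τ : ℝ) * s).toNNReal) ∉ A := fun s ↦ by
      refine notMem_of_lt_firstHit (lt_of_le_of_lt ?_ hτA)
      have : ((τ : ℝ) * s).toNNReal ≤ τ := by
        rw [← NNReal.coe_le_coe, Real.coe_toNNReal _ (mul_nonneg τ.coe_nonneg s.2.1)]
        exact mul_le_of_le_one_right τ.coe_nonneg s.2.2
      exact_mod_cast this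
    have hcontL : Continuous (fun s : I ↦ ψ.boundaryExtension
        (sleTrace 6 ω (((τ : ℝ) * s).toNNReal))) :=
      hcontψ.comp (continuous_const.mul continuous_subtype_val)
    have hpath : Continuous fun s : I ↦ sleTrace 6 ω (((τ : ℝ) * s).toNNReal) :=
      hgen.continuous.comp (continuous_real_toNNReal.comp (continuous_const.mul continuous_subtype_val))
    have hcontR : Continuous (fun s : I ↦ starMap A (sleTrace 6 ω (((τ : ℝ) * s).toNNReal))) :=
      (continuousOn_starMap hA).comp_continuous hpath fun s ↦ ⟨him _, hnotA s⟩
    rw [stoppedPathClass_eq hcontL, stoppedPathClass_eq hcontR, CurveClass.map_mk]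
    have heq : (⟨⟨fun s : I ↦ ψ.boundaryExtension (sleTrace 6 ω (((τ : ℝ) * s).toNNReal)),
        hcontL⟩⟩ : Curve ℂ) =
        Curve.map Ψs ⟨⟨fun s : I ↦ starMap A (sleTrace 6 ω (((τ : ℝ) * s).toNNReal)), hcontR⟩⟩ := by
      refine Curve.ext (ContinuousMap.ext fun s ↦ ?_)
      change ψ.boundaryExtension (sleTrace 6 ω (((τ : ℝ) * s).toNNReal)) =
        Ψs (starMap A (sleTrace 6 ω (((τ : ℝ) * s).toNNReal)))
      rw [hΨs _ (starMap_im_nonneg hA (him _) (hnotA s)),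
        ConformalEquiv.boundaryExtension_pullbackChordal_starMap hD'.carrier_subset hA (him _) (hnotA s)]
    rw [heq]
  -- identification of the `μ'`-event
  have h2 : Γ' ⁻¹' (CurveClass.stopAt G ⁻¹' T) =ᵐ[preWienerMeasure]
      {ω | stoppedPathClass id (sleTrace 6 ω)
        ((firstHit (sleTrace 6 ω) S).untopD 0) ∈ T'} := by
    filter_upwards [hae', htr] with ω hω hωtr
    obtain ⟨hgen, c', hΓ'c, hc'⟩ := hω
    have him := hgen.im_nonneg
    have hfin : firstHit (sleTrace 6 ω) S ≠ ⊤ :=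
      firstHit_ne_top_of_tendsto_norm him hωtr fun z hz hRz ↦ ⟨hz, hR z hz hRz⟩
    obtain ⟨τ, hτ, -⟩ := exists_firstHit_eq_coe hgen.continuous hS hfin
    refine propext ?_
    change Γ' ω ∈ CurveClass.stopAt G ⁻¹' T ↔
      stoppedPathClass id (sleTrace 6 ω)
        ((firstHit (sleTrace 6 ω) S).untopD 0) ∈ CurveClass.map Ψs ⁻¹' T
    rw [hΓ'c, mem_preimage, CurveClass.stopAt_mk_holds _ hG, mem_preimage, hτ, WithTop.untopD_coe]
    have hΨF : ∀ t, ψ'.boundaryExtension (sleTrace 6 ω t) ∈ G ↔ sleTrace 6 ω t ∈ S :=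
      fun t ↦ ⟨fun h ↦ ⟨him t, h⟩, fun h ↦ h.2⟩
    have hcontψ' := continuous_comp_of_isGeneratedByCurve hΨ'cont hgen
    have hb'' : D'.pt 1 = D'.pt 1 := rfl
    have hA' := mk_stopAt_eq_stoppedPathClass hG hS hgen.continuous hΨF hc' hτ hcontψ'.continuousOn
    rw [hA']
    have hcontL : Continuous (fun s : I ↦ ψ'.boundaryExtension
        (sleTrace 6 ω (((τ : ℝ) * s).toNNReal))) :=
      hcontψ'.comp (continuous_const.mul continuous_subtype_val)
    have hcontR := continuous_stoppedPath_id hgen.continuous τ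
    rw [stoppedPathClass_eq hcontL, stoppedPathClass_eq hcontR, CurveClass.map_mk]
    have heq : (⟨⟨fun s : I ↦ ψ'.boundaryExtension (sleTrace 6 ω (((τ : ℝ) * s).toNNReal)),
        hcontL⟩⟩ : Curve ℂ) =
        Curve.map Ψs ⟨⟨fun s : I ↦ id (sleTrace 6 ω (((τ : ℝ) * s).toNNReal)), hcontR⟩⟩ := by
      refine Curve.ext (ContinuousMap.ext fun s ↦ ?_)
      change ψ'.boundaryExtension (sleTrace 6 ω (((τ : ℝ) * s).toNNReal)) =
        Ψs (id (sleTrace 6 ω (((τ : ℝ) * s).toNNReal)))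
      rw [id, hΨs _ (him _)]
    rw [heq]
  rw [measure_congr h2, measure_congr h1]
  exact key.symm

/-! ### The assembly -/

/-- **The bounded clause of the restriction form of the locality of chordal SLE₆, from the
neighbourhood half-plane form** ([LSW 2001] Cor. 2.4 for hull subdomains, i.e. under its printed hypothesis
`a, b ∉ \bar I`): `IsSLELaw.locality_six_bounded` follows from `sle_six_hull_locality`.
[cite: LawlerSchrammWerner2001, Cor 2.4] -/
theorem IsSLELaw.locality_six_bounded_of_hull_nbhd (hH : sle_six_hull_locality_nbhd) :
    IsSLELaw.locality_six_bounded := by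
  intro D D' μ μ' hμ hμ' hD' T hT
  haveI : Fact isProjectiveLimit_preWienerMeasure := ⟨isProjectiveLimit_preWienerMeasure_holds⟩
  by_cases hne : D'.carrier = D.carrier
  · -- equal carriers: the two laws coincide
    rw [hμ'.unique' (hμ.of_carrier_eq hne hD'.pt_zero_eq hD'.pt_one_eq)]
  set F : Set ℂ := closure (D.carrier \ D'.carrier) with hFdef
  have hF : IsClosed F := isClosed_closure
  haveI := hμ.isProbabilityMeasure
  haveI := hμ'.isProbabilityMeasure
  obtain ⟨Γ, ⟨hΓm, ψ, hψ, hae⟩, rfl⟩ := hμ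
  obtain ⟨Γ', ⟨hΓ'm, ψ', hψ', hae'⟩, hμ'eq⟩ := id hμ'
  -- the clause for every thickening of `F ∪ {b}`
  have hclause : ∀ n : ℕ, ∀ T : Set (CurveClass ℂ), MeasurableSet T →
      μ' (CurveClass.stopAt (cthickening (1 / ((n : ℝ) + 1)) (F ∪ {D.pt 1})) ⁻¹' T) =
        preWienerMeasure.map Γ
          (CurveClass.stopAt (cthickening (1 / ((n : ℝ) + 1)) (F ∪ {D.pt 1})) ⁻¹' T) := by
    intro n T hT
    have hδ : 0 < 1 / ((n : ℝ) + 1) := by positivity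
    refine measure_stopAt_preimage_eq_of_hull_nbhd hH hD' hne hΓm ψ hψ hae hμ' isClosed_cthickening hδ
      (cthickening_subset_of_subset _ subset_union_left) hδ ?_ hT
    exact (closedBall_subset_cthickening_singleton _ _).trans
      (cthickening_subset_of_subset _ subset_union_right)
  have hunion : μ' (CurveClass.stopAt (F ∪ {D.pt 1}) ⁻¹' T) =
      preWienerMeasure.map Γ (CurveClass.stopAt (F ∪ {D.pt 1}) ⁻¹' T) :=
    measure_preimage_stopAt_eq_of_forall_cthickening (hF.union isClosed_singleton) hclause hT
  -- from `F ∪ {b}` to `F`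
  rw [hμ'eq, CurveClass.map_apply_stopAt_preimage hΓ'm hF hT,
    CurveClass.map_apply_stopAt_preimage hΓm hF hT,
    measure_congr (preimage_stopAt_union_pt_one_ae_eq ψ' hψ' hae' hF T),
    measure_congr (preimage_stopAt_union_pt_one_ae_eq ψ hψ hae hF T), hD'.pt_one_eq,
    ← CurveClass.map_apply_stopAt_preimage hΓ'm (hF.union isClosed_singleton) hT,
    ← CurveClass.map_apply_stopAt_preimage hΓm (hF.union isClosed_singleton) hT, ← hμ'eq]
  exact hunion

end Literature.Probability.RandomPlanarGeometry

end
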